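import Summits.BirchSwinnertonDyer.BirchSwinnertonDyer.Theorems.PrintCf2SplitBadTwoNormAtVbarTwistedAssemblyLine
import Summits.BirchSwinnertonDyer.BirchSwinnertonDyer.Theorems.PrintCf2SplitBadTwoSignRetwistOnDecomp
import Summits.BirchSwinnertonDyer.BirchSwinnertonDyer.Theorems.PrintCf2SplitBadTwoQuadraticSignRamification
import HarnessLib

/-!
# Crux `PrintCf2.SplitBadTwoRankOneOfFacts` (stmt-BirchSwinnertonDyer-20368) — M-LINE-PIN stub (R) `stub_xRegularInner` of the DECIDING child
# (`Cruxes/MainConjClauseAtSplitTwoQuad/Lines/m_line_pin.lean`; route-C rev 16 child stmt-BirchSwinnertonDyer-24721): THE TWISTED INERT `v̄`-READING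
# ON THE `v`-LINE OF A DA7 FRAME (case (B1), slack `m`) — the displayed hypothesis `hB1v` of the (R)-socket
# `XRegInnerClose.stub_xRegularInner_of_inertReading` / `hB1` of `LayerShapiroSlack.locSurj_layers_charModule_vLine_of_decompReading`, DISCHARGED

Cell `bsd-print-cf2`, WIDTH seat `bsd-line-cf2-p1-w2` g15 (prover-bsd-line-cf2-p1-w2-g15-0); `--supports` helper (Theses-free). HONEST FRAMING:
nothing here closes the crux or a registered stub by itself (the closer `XRegInnerClose.stub_xRegularInner` is the sequel
`…LinePinXRegularInnerOfInertReading`); BSD is not proved by any of this; no summit statement is proved by this seat. No definition, no named fact, no `sorry`.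

WHAT. On `K` with `disc K = −7`, `2 = v v̄`, the `ℤ₂`-line `κ₁` unramified outside `v` has `v̄` UNDECOMPOSED (cf2c-w8 g4
`LinePin.exists_mem_decomp_vbar_apply_eq_of_discr`: `τ ∈ D_v̄` with `κ₁ τ = κ₁ γ₁`; with `Γ_K = ⋃ⱼ γ₁^j U_m` — my p711201
`XRegClose.exists_pow_inv_mul_mem_layerSubgroup` — this gives `Γ_K = D_v̄ · U_m`), so -w4 g14's LINE-GENERIC B5-T assembly
`NormAtVbar.dvd_mul_log_valuation_of_dualShapiro_mem_twisted` (p712897; case (B1) `ε′|_{D_v̄} = 1`; built on -w3 g14's FILES 1–6, -w4 g14's twisted Kummer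
reading p709686 and transfer p710167) applies at `U := U_m = κ₁.layerSubgroup m` — §1 **`dvd_index_mul_log_valuation_of_dualShapiro_mem_twisted_of_subgroup`**
is that theorem over any open normal finite-index `U` with `Gal(K̄/F) = U` (`subst`; `F` from -w4 g14 `KummerUDict.exists_twistedLayerField κ₁ m 1`) —
with `n := 2^M` and `m₀` the `ε′`-eigenvector of the pointed models: `2^M ∣ [Γ_K : U_m] · ord_{w′}(b′) = 2^m · ord_{w′}(b′)` (`ZpExtension.index_layerSubgroup`),
i.e. `2^{M−m} ∣ ord_{w′}(b′)` (-w4 `NormAtVbar.pow_sub_dvd_of_pow_dvd_mul`) — §2 **`inertReading_vLine`**, the LEFT disjunct of `hB1v`, binder-for-binder.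
presearch: «Leopoldt / local surjectivity over Z_p-extensions, inert prime reading» → Greenberg LNM 1716 Props. 4.13–4.15, Rubin 1991 §5 p. 43, NSW (1.6.4);
assembly of tree theorems, no new fact. beyond-print theorem: no.

References: [NeukirchSchmidtWingberg2008] I §5 Prop. (1.5.3)(iv), I §6 (1.6.4); [NeukirchANT1999] Ch. I §9 (9.4), (9.6); [Washington1997] §13.1;
[SerreLocalFields1979] XIV §1 Prop. 3.
-/

noncomputable section

set_option linter.dupNamespace false
set_option autoImplicit false

open scoped Classical ContRepresentation Pointwise
open CategoryTheory NumberField IsDedekindDomain Field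
open Literature.NumberTheory.EllipticCurves Literature.NumberTheory.EllipticCurves.GreenbergSelmer
open Literature.NumberTheory.EllipticCurves.GreenbergVatsal2000 Literature.NumberTheory.EllipticCurves.KellerYin2024
open Literature.NumberTheory.GaloisRepresentations Literature.NumberTheory.GaloisRepresentations.LocalWeilDatum
open Literature.NumberTheory.GaloisRepresentations.DiscreteGaloisModule (SelmerStructure mu MuCarrier TateDual tateDual
  coindTateDualMor coindTateDualHom)
open Literature.NumberTheory.GaloisCohomology
open Summit.BirchSwinnertonDyer.Rank1Residual.X11b.LocBridge
open Summit.BirchSwinnertonDyer.BirchSwinnertonDyer.Theorems Summit.BirchSwinnertonDyer.BirchSwinnertonDyer.Theorems.PrintCf2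

namespace Summit.BirchSwinnertonDyer.BirchSwinnertonDyer.Theorems.PrintCf2.XRegInnerClose

/-! ## §1–§2. -w4 g14's line-generic B5-T assembly over any `U`; the twisted INERT `v̄`-reading on the `v`-LINE (`hB1v`) -/

/-- **`U`-generic form of -w4 g14's `NormAtVbar.dvd_mul_log_valuation_of_dualShapiro_mem_twisted`** (p71xxxx, line-generic B5-T, case (B1),
slack `[Γ_K : U]`): the same statement over any open normal `U` of finite index with `Gal(K̄/F) = U` (`subst`), so that it applies to
`U := κ₁.layerSubgroup m` literally. [cite: NeukirchSchmidtWingberg2008, I §5 Prop. (1.5.3)(iv), I §6 (1.6.4)] [cite: NeukirchANT1999, Ch. I §9 (9.4), (9.6)] -/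
theorem dvd_index_mul_log_valuation_of_dualShapiro_mem_twisted_of_subgroup {K : Type} [Field K] [NumberField K]
    (U : Subgroup (absoluteGaloisGroup K)) [U.Normal] (hUopen : IsOpen (U : Set (absoluteGaloisGroup K)))
    [Fintype (absoluteGaloisGroup K ⧸ U)] (F : IntermediateField K (AlgebraicClosure K)) (hUF : galFixing K F = U)
    {N : Type} [AddCommGroup N] [DistribMulAction (absoluteGaloisGroup K) N] [TopologicalSpace N] [DiscreteTopology N] [Finite N]
    {N' : Type} [AddCommGroup N'] [DistribMulAction (absoluteGaloisGroup K) N'] [TopologicalSpace N'] [DiscreteTopology N']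
    (hN : ∀ m : N, IsOpen {σ : absoluteGaloisGroup K | σ • m = m}) (hN' : ∀ m : N', IsOpen {σ : absoluteGaloisGroup K | σ • m = m})
    {n : ℕ} [NeZero n] (B : N →+ N' →+ MuCarrier K n)
    (hB : ∀ (σ : absoluteGaloisGroup K) (m : N) (m' : N'), B (ofSMul N hN σ m) (ofSMul N' hN' σ m') = mu K n σ (B m m'))
    (F' : IntermediateField K (AlgebraicClosure K)) [IsAbelianGalois K F'] [NumberField F']
    (ε : absoluteGaloisGroup K →* ℤˣ) (hε : IsOpen ((ε.ker : Subgroup (absoluteGaloisGroup K)) : Set (absoluteGaloisGroup K)))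
    (hU' : galFixing K F' ≤ U) (hεU' : ∀ u ∈ galFixing K F', ε u = 1) (hker : ∀ u ∈ U, ε u = 1 → u ∈ galFixing K F')
    {m₀ : N} (hm₀ : ∀ σ : absoluteGaloisGroup K, ofSMul N hN σ m₀ = ((ε σ : ℤˣ) : ℤ) • m₀) (hn0 : n • m₀ = 0)
    (hMn' : ∀ x : N', n • x = 0)
    (ι' : N' →+ Additive (AlgebraicClosure K)ˣ) (hι'B : ∀ m' : N', Additive.toMul (ι' m') = muVal K n (B m₀ m'))
    (hι' : ∀ (g : absoluteGaloisGroup K) (x : N'), Additive.toMul (ι' (g • x)) = (g • Additive.toMul (ι' x)) ^ ((ε g : ℤˣ) : ℤ))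
    (vbar : HeightOneSpectrum (𝓞 K))
    (hDU : ∀ σ : absoluteGaloisGroup K, ∃ τ ∈ GreenbergSelmer.decomp vbar, τ⁻¹ * σ ∈ U)
    (hεD : ∀ σ ∈ GreenbergSelmer.decomp vbar, ε σ = 1)
    {s : absoluteGaloisGroup K ⧸ U → absoluteGaloisGroup K}
    (hs : ∀ y, (s y : absoluteGaloisGroup K ⧸ U) = y) (hs1 : s ((1 : absoluteGaloisGroup K) : absoluteGaloisGroup K ⧸ U) = 1)
    (φ : contOneCocycles (discreteTopRep U N'))
    (hvbar : galoisCohomology.localization (((ofSMul N hN).coind U hUopen).tateDual n) (Sum.inr vbar) 1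
        (cohomologyMap (coindTateDualMor (ofSMul N hN) (ofSMul N' hN') U B hUopen hB) 1
          (shapiroLift (ofSMul N' hN').toTopRep U hUopen hs hs1 (oneCocycleClass _ φ))) ∈
      (LocalInvariants.canonical K n).dualLocalCondition ((ofSMul N hN).coind U hUopen) (Sum.inr vbar)
        (DiscreteGaloisModule.unramifiedSubgroup (GaloisRep.toLocal vbar ((ofSMul N hN).coind U hUopen)) 1))
    (β : (AlgebraicClosure K)ˣ)
    (hβ : ∀ u : galFixing K F', Additive.toMul (ι' (φ.1 ⟨u, hU' u.2⟩)) = (u : absoluteGaloisGroup K) • β / β)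
    (b : F') (hb : ((b : F') : AlgebraicClosure K) = ((β ^ n : (AlgebraicClosure K)ˣ) : AlgebraicClosure K))
    (w' : vbar.Extension (𝓞 F')) : (n : ℤ) ∣ (U.index : ℤ) * WithZero.log (w'.1.valuation F' b) := by
  subst hUF
  exact NormAtVbar.dvd_mul_log_valuation_of_dualShapiro_mem_twisted (ofSMul N hN) hN' B hB F F' hUopen ε hε hU' hεU' hker hm₀ hn0 hMn'
    ι' hι'B hι' vbar hDU hεD hs hs1 φ hvbar β hβ b hb w'

/-- **`hB1v` DISCHARGED: the twisted INERT `v̄`-reading on the `v`-LINE of a DA7 frame** (case (B1), slack `m` at the layer `K^{(v)}_m`). On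
`K` with `disc K = −7`, `2 = v v̄`, the `ℤ₂`-line `κ₁` unramified outside `v` has `v̄` UNDECOMPOSED (cf2c-w8 g4 `LinePin.exists_mem_decomp_vbar_apply_eq_of_discr`:
`τ ∈ D_v̄` with `κ₁ τ = κ₁ γ₁`; with `Γ_K = ⋃ⱼ γ₁^j U_m` this gives `Γ_K = D_v̄ · U_m`), so -w4 g14's line-generic B5-T assembly applies with
`U := U_m = κ₁.layerSubgroup m` (`Gal(K̄/F) = U_m`, `F` from `exists_twistedLayerField κ₁ m 1`), `n := 2^M`, `m₀` the `ε′`-eigenvector of the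
pointed models: `2^M ∣ [Γ_K : U_m] · ord_{w′}(b′) = 2^m · ord_{w′}(b′)` (`ZpExtension.index_layerSubgroup`), i.e. `2^{M−m} ∣ ord_{w′}(b′)` — the LEFT
disjunct of `hB1v`. [cite: NeukirchSchmidtWingberg2008, I §6 (1.6.4)] [cite: Washington1997, §13.1] [cite: NeukirchANT1999, Ch. I §9 (9.6)] -/
theorem inertReading_vLine :
    ∀ (K : Type) [Field K] [NumberField K], IsImaginaryQuadratic K → NumberField.discr K = -7 →
      ∀ (v vbar : HeightOneSpectrum (𝓞 K)), ((2 : ℕ) : 𝓞 K) ∈ v.asIdeal → ((2 : ℕ) : 𝓞 K) ∈ vbar.asIdeal → vbar ≠ v →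
      ∀ (κ₁ : ZpExtension K 2), κ₁.IsUnramifiedOutside v → ∀ (m : ℕ), 1 ≤ m →
      ∀ [Fintype (absoluteGaloisGroup K ⧸ κ₁.layerSubgroup m)],
      ∀ (θ' : FramedGaloisRep K (padicCoeffIntegers (∅ : Set (PadicAlgCl 2))) 1), (∀ σ : absoluteGaloisGroup K, θ' σ ^ 2 = 1) →
      ∀ (ε' : absoluteGaloisGroup K →* ℤˣ),
      (haveI : Fact (Nat.Prime 2) := ⟨Nat.prime_two⟩; ∀ σ, ε' σ = 1 ↔ unitChar θ' σ = 1) →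
      IsOpen ((ε'.ker : Subgroup (absoluteGaloisGroup K)) : Set (absoluteGaloisGroup K)) →
      (∀ σ ∈ decomp (K := K) vbar, ε' σ = 1) →
      ∀ (F' : IntermediateField K (AlgebraicClosure K)) [FiniteDimensional K F'] [IsAbelianGalois K F'] [NumberField F']
      [(galFixing K F').Normal] (hU' : galFixing K F' ≤ κ₁.layerSubgroup m) (_hεU' : ∀ u ∈ galFixing K F', ε' u = 1)
      (_hker : ∀ u ∈ κ₁.layerSubgroup m, ε' u = 1 → u ∈ galFixing K F')
      (M : ℕ) {N : Type} [AddCommGroup N] [DistribMulAction (absoluteGaloisGroup K) N] [TopologicalSpace N] [DiscreteTopology N]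
      [Finite N] {N' : Type} [AddCommGroup N'] [DistribMulAction (absoluteGaloisGroup K) N'] [TopologicalSpace N'] [DiscreteTopology N']
      (hN : ∀ m : N, IsOpen {σ : absoluteGaloisGroup K | σ • m = m}) (hN' : ∀ m : N', IsOpen {σ : absoluteGaloisGroup K | σ • m = m})
      (_hNε : ∀ (σ : absoluteGaloisGroup K) (x : N), σ • x = ((ε' σ : ℤˣ) : ℤ) • x)
      (_hMN : ∀ x : N, 2 ^ M • x = 0) (_hMN' : ∀ x : N', 2 ^ M • x = 0)
      (B : N →+ N' →+ MuCarrier K (2 ^ M))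
      (hB : ∀ (σ : absoluteGaloisGroup K) (m : N) (m' : N'), B (ofSMul N hN σ m) (ofSMul N' hN' σ m') = mu K (2 ^ M) σ (B m m'))
      (_hBbij : Function.Bijective fun m' : N' ↦ B.flip m')
      (ι' : N' →+ Additive (AlgebraicClosure K)ˣ) (_hι'inj : Function.Injective ι')
      (_hι' : ∀ (g : absoluteGaloisGroup K) (x : N'), Additive.toMul (ι' (g • x)) = (g • Additive.toMul (ι' x)) ^ ((ε' g : ℤˣ) : ℤ))
      (m₀ : N) (_hι'B : ∀ m' : N', Additive.toMul (ι' m') = muVal K (2 ^ M) (B m₀ m'))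
      {s : absoluteGaloisGroup K ⧸ κ₁.layerSubgroup m → absoluteGaloisGroup K}
      (hs : ∀ y, (s y : absoluteGaloisGroup K ⧸ κ₁.layerSubgroup m) = y)
      (hs1 : s ((1 : absoluteGaloisGroup K) : absoluteGaloisGroup K ⧸ κ₁.layerSubgroup m) = 1)
      (φ : contOneCocycles (discreteTopRep (κ₁.layerSubgroup m) N')),
      galoisCohomology.localization (((ofSMul N hN).coind (κ₁.layerSubgroup m) (κ₁.isOpen_layerSubgroup m)).tateDual (2 ^ M))
          (Sum.inr vbar) 1
          (cohomologyMap (coindTateDualMor (ofSMul N hN) (ofSMul N' hN') (κ₁.layerSubgroup m) B (κ₁.isOpen_layerSubgroup m) hB) 1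
            (shapiroLift (ofSMul N' hN').toTopRep (κ₁.layerSubgroup m) (κ₁.isOpen_layerSubgroup m) hs hs1 (oneCocycleClass _ φ))) ∈
        (LocalInvariants.canonical K (2 ^ M)).dualLocalCondition ((ofSMul N hN).coind (κ₁.layerSubgroup m) (κ₁.isOpen_layerSubgroup m))
          (Sum.inr vbar)
          (DiscreteGaloisModule.unramifiedSubgroup
            (GaloisRep.toLocal vbar ((ofSMul N hN).coind (κ₁.layerSubgroup m) (κ₁.isOpen_layerSubgroup m))) 1) →
      ∀ β : (AlgebraicClosure K)ˣ,
        (∀ u : galFixing K F', Additive.toMul (ι' (φ.1 ⟨u, hU' u.2⟩)) = (u : absoluteGaloisGroup K) • β / β) →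
        ∀ b : F', ((b : F') : AlgebraicClosure K) = ((β ^ 2 ^ M : (AlgebraicClosure K)ˣ) : AlgebraicClosure K) →
        ∀ w' : vbar.Extension (𝓞 F'),
          ((2 ^ (M - m) : ℕ) : ℤ) ∣ WithZero.log (w'.1.valuation F' b) ∨
          ∃ 𝔓 : Ideal (absIntegers (𝓞 K) K),
            𝔓.comap (ringOfIntegersToIntegralClosure (k := K) (Ω := AlgebraicClosure K) F') = w'.1.asIdeal ∧
            ∃ s ∈ κ₁.layerSubgroup m, ε' s ≠ 1 ∧ s • 𝔓 = 𝔓 := by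
  intro K _ _ hK hdK v vbar hv hvbar hne κ₁ hκ₁ m _ _ _ _ ε' _ hε'o hε'D F' _ _ _ _ hU' hεU' hker M N _ _ _ _ _ N' _ _ _ _ hN hN' hNε
    hMN hMN' B hB _ ι' _ hι' m₀ hι'B s hs hs1 φ hcl β hβ b hb w'
  haveI : Fact (Nat.Prime 2) := ⟨Nat.prime_two⟩
  left
  -- the layer field `F` with `Gal(K̄/F) = U_m`
  have hε1 : IsOpen ((1 : absoluteGaloisGroup K →* ℤˣ).ker : Set (absoluteGaloisGroup K)) := by
    rw [MonoidHom.ker_one]; exact isOpen_univ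
  obtain ⟨F, hFU, -, hfdF, habF, hnfF, hnF⟩ := KummerUDict.exists_twistedLayerField κ₁ m (1 : absoluteGaloisGroup K →* ℤˣ) hε1
  have hUF : galFixing K F = κ₁.layerSubgroup m := by rw [hFU, MonoidHom.ker_one, inf_top_eq]
  -- `Γ_K = D_v̄ · U_m` (DA7: `v̄` undecomposed on the `v`-line)
  obtain ⟨γ₁, hγ₁⟩ := κ₁.surjective (Multiplicative.ofAdd 1)
  have hγ₁' : κ₁.IsTopGenerator γ₁ := hγ₁
  obtain ⟨τ, hτD, hτ⟩ := LinePin.exists_mem_decomp_vbar_apply_eq_of_discr hK hdK hv hvbar hne κ₁ hκ₁ hγ₁'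
  have hDU : ∀ σ : absoluteGaloisGroup K, ∃ τ' ∈ GreenbergSelmer.decomp vbar, τ'⁻¹ * σ ∈ κ₁.layerSubgroup m := by
    intro σ
    obtain ⟨j, hj⟩ := XRegClose.exists_pow_inv_mul_mem_layerSubgroup κ₁ hγ₁' m σ
    refine ⟨τ ^ j, Subgroup.pow_mem _ hτD j, ?_⟩
    have h1 : (τ ^ j)⁻¹ * γ₁ ^ j ∈ κ₁.layerSubgroup m := by
      apply κ₁.kerSubgroup_le_layerSubgroup m
      rw [ZpExtension.mem_kerSubgroup, map_mul, map_inv, map_pow, map_pow, hτ, inv_mul_cancel]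
    have h2 : (τ ^ j)⁻¹ * σ = ((τ ^ j)⁻¹ * γ₁ ^ j) * ((γ₁ ^ j)⁻¹ * σ) := by group
    rw [h2]
    exact Subgroup.mul_mem _ h1 hj
  -- the `ε′`-eigenvector `m₀`
  have hm₀ : ∀ σ : absoluteGaloisGroup K, ofSMul N hN σ m₀ = ((ε' σ : ℤˣ) : ℤ) • m₀ := fun σ ↦ by rw [ofSMul_apply_apply, hNε]
  -- -w4 g14's line-generic assembly at `U := U_m`
  have hmain := dvd_index_mul_log_valuation_of_dualShapiro_mem_twisted_of_subgroup (κ₁.layerSubgroup m) (κ₁.isOpen_layerSubgroup m) F hUF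
    hN hN' B hB F' ε' hε'o hU' hεU' hker hm₀ (hMN m₀) hMN' ι' hι'B hι' vbar hDU hε'D hs hs1 φ hcl β hβ b hb w'
  rw [ZpExtension.index_layerSubgroup] at hmain
  have h2 : (2 : ℤ) ^ M ∣ (2 : ℤ) ^ m * WithZero.log (w'.1.valuation F' b) := by exact_mod_cast hmain
  have h3 := NormAtVbar.pow_sub_dvd_of_pow_dvd_mul (two_ne_zero) h2
  exact_mod_cast h3

end Summit.BirchSwinnertonDyer.BirchSwinnertonDyer.Theorems.PrintCf2.XRegInnerClose

end
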